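import Literature.NumberTheory.LFunctions.WeilBochnerRepresentation
import Summits.RiemannHypothesis.RiemannHypothesis.Theorems.WeilFormatCWindowCutoff
import Summits.RiemannHypothesis.RiemannHypothesis.Theorems.WeilFormatCWindowLimit
import Summits.RiemannHypothesis.RiemannHypothesis.Theorems.WeilGroundStateGroundStateSimpleEvenStubParabolaRayleigh
import Mathlib.Analysis.SpecialFunctions.Integrals.Basic
import HarnessLib

/-!
# RiemannHypothesis — the Weil energy of a smooth plateau of width `r` is `O(r log(1/r))`

Helper file (`--supports stmt-RiemannHypothesis-0098`), RH-free, standard axioms.  Seat rh-explicit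
weil-3 (structure).  First half of the growth law `μ[-T, T] = O(T log T)` for every positive measure
`μ` representing Weil's form on a window (`WeilBochnerMeasureGrowth.lean`): the two estimates on the
probing test function.

For `0 < r ≤ (log 2)/2` let `g_r = η` be a smooth plateau (`η = 1` on `[-r/2, r/2]`, `0 ≤ η ≤ 1`,
`η = 0` for `|x| ≥ 3r/4`, Lipschitz constant `L/r`; `exists_plateau`, from the tree's
`WeilFormatC.exists_smooth_plateau`).  Then

* `re_weilMellin_plateau_ge`: `Re ĝ_r(½+it) ≥ cos 1 · r` for `|t| r ≤ 1` (`cos(tx) ≥ cos 1` on the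
  support and `∫ η ≥ r`);
* `re_weilQuadratic_plateau_le`: `Re Q(g_r) ≤ r · (A + 8 log(1/r))` with `A` independent of `r`, by the
  Markov decomposition `Re Q = P + 𝓔_r − M_r ‖·‖₂²` on the window `[-r, r]`
  (`weilQuadratic_re_eq_weilPoleForm_add_weilDirichletEnergy_sub`): no prime power enters
  (`GroundStateSimpleEven.par_weilDirichletEnergy_eq`, tree), the pole form is `≤ 8 cosh²(½) r²`, the killing term
  is `≤ 2|M₀| r`, and the archimedean energy `∫₀^∞ w(t) D_t(g_r) dt` splits as
  `∫₀^r + ∫_r^1 + ∫_1^∞ ≤ (2L² + 2) r + 8 r log(1/r) + 8 r ∫_1^∞ w` using the window-function bounds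
  `D_t ≤ 2rS₁²t² + 2S₀²t`, `D_t ≤ 8rS₀²` (`WeilFormatCWindowFamily`) and `w(t) ≤ 1/t` on `(0, 1]`.
-/

noncomputable section

set_option linter.dupNamespace false  -- the mandated namespace repeats `RiemannHypothesis`

open Complex Filter Set MeasureTheory
open scoped Real Topology ContDiff ComplexConjugate ArithmeticFunction.vonMangoldt
open Literature.NumberTheory.LFunctions
open Summit.RiemannHypothesis.RiemannHypothesis.Theorems.WeilFormatC

namespace Summit.RiemannHypothesis.RiemannHypothesis.Theorems.WeilBochnerMeasure

/-! ## Smooth plateaus of width `r` -/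

/-- **Smooth plateaus.**  There is `L ≥ 0` such that for every `r > 0` there is a smooth
`η : ℝ → ℝ` with `0 ≤ η ≤ 1`, `η = 1` on `[-r/2, r/2]`, `η = 0` off `(-r, r)`… precisely `η x = 0` for
`3r/4 ≤ |x|`, and `|η x − η y| ≤ (L/r)|x − y|` (`exists_smooth_plateau` with `a = r`, `ε = r/4`). -/
theorem exists_plateau : ∃ L : ℝ, 0 ≤ L ∧ ∀ r : ℝ, 0 < r →
    ∃ η : ℝ → ℝ, ContDiff ℝ ∞ η ∧ (∀ x, 0 ≤ η x ∧ η x ≤ 1) ∧ (∀ x, |x| ≤ r / 2 → η x = 1) ∧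
      (∀ x, 3 * r / 4 ≤ |x| → η x = 0) ∧ ∀ x y, |η x - η y| ≤ L / r * |x - y| := by
  obtain ⟨C, hC0, hC⟩ := exists_lipschitz_smoothTransition
  refine ⟨8 * C, by positivity, fun r hr ↦ ?_⟩
  obtain ⟨η, hηs, hη01, hη1, hη0, hηL⟩ := exists_smooth_plateau (a := r) (ε := r / 4) (by positivity) hC
  refine ⟨η, hηs, hη01, fun x hx ↦ hη1 x (by linarith), fun x hx ↦ hη0 x (by linarith), fun x y ↦ ?_⟩
  have h := hηL x y
  have e : 2 * C / (r / 4) = 8 * C / r := by field_simp; ring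
  rwa [e] at h

variable {r : ℝ} {η : ℝ → ℝ}

/-- The complexified plateau is a Weil test supported in `[-r, r]`. -/
theorem isWeilTest_plateau (hηs : ContDiff ℝ ∞ η) (hη0 : ∀ x, 3 * r / 4 ≤ |x| → η x = 0) (hr : 0 < r) :
    IsWeilTest (fun x ↦ ((η x : ℝ) : ℂ)) ∧ tsupport (fun x ↦ ((η x : ℝ) : ℂ)) ⊆ Icc (-r) r := by
  have hsupp : Function.support (fun x ↦ ((η x : ℝ) : ℂ)) ⊆ Icc (-(3 * r / 4)) (3 * r / 4) := by
    intro x hx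
    rw [Function.mem_support, ne_eq, Complex.ofReal_eq_zero] at hx
    by_contra h
    rw [mem_Icc, ← abs_le, not_le] at h
    exact hx (hη0 x h.le)
  have hts : tsupport (fun x ↦ ((η x : ℝ) : ℂ)) ⊆ Icc (-(3 * r / 4)) (3 * r / 4) :=
    closure_minimal hsupp isClosed_Icc
  refine ⟨⟨Complex.ofRealCLM.contDiff.comp hηs, ?_⟩, hts.trans (Icc_subset_Icc (by linarith) (by linarith))⟩
  exact IsCompact.of_isClosed_subset isCompact_Icc (isClosed_tsupport _) hts

/-- **Low-frequency lower bound**: for a plateau `η` (`0 ≤ η`, `η = 1` on `[-r/2, r/2]`, `η = 0` for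
`|x| ≥ 3r/4`) and `|t| r ≤ 1`: `cos 1 · r ≤ Re η̂(½+it)` (`cos(tx) ≥ cos 1` on the support,
`∫ η ≥ r`). -/
theorem re_weilMellin_plateau_ge (hηs : ContDiff ℝ ∞ η) (hη01 : ∀ x, 0 ≤ η x ∧ η x ≤ 1)
    (hη1 : ∀ x, |x| ≤ r / 2 → η x = 1) (hη0 : ∀ x, 3 * r / 4 ≤ |x| → η x = 0) (hr : 0 < r)
    {t : ℝ} (ht : |t| * r ≤ 1) :
    Real.cos 1 * r ≤ (weilMellin (fun x ↦ ((η x : ℝ) : ℂ)) (1 / 2 + (t : ℂ) * I)).re := by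
  obtain ⟨hg, hgs⟩ := isWeilTest_plateau hηs hη0 hr
  have hηc : Continuous η := hηs.continuous
  have hηcs : HasCompactSupport η := by
    refine HasCompactSupport.of_support_subset_isCompact (isCompact_Icc (a := -r) (b := r)) fun x hx ↦ ?_
    rw [Function.mem_support] at hx
    by_contra h
    rw [mem_Icc, ← abs_le, not_le] at h
    exact hx (hη0 x (by linarith [h.le]))
  have hexp : ∀ x : ℝ, (1 / 2 + (t : ℂ) * I - 1 / 2) * (x : ℂ) = ((t * x : ℝ) : ℂ) * I :=
    fun x ↦ by push_cast; ring
  have hint : Integrable fun x : ℝ ↦ ((η x : ℝ) : ℂ) * cexp ((1 / 2 + (t : ℂ) * I - 1 / 2) * (x : ℂ)) := by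
    refine Continuous.integrable_of_hasCompactSupport ?_ ?_
    · exact (Complex.continuous_ofReal.comp hηc).mul (by fun_prop)
    · exact (hηcs.comp_left Complex.ofReal_zero).mul_right
  have hre : ∀ x : ℝ, ((((η x : ℝ) : ℂ)) * cexp ((1 / 2 + (t : ℂ) * I - 1 / 2) * (x : ℂ))).re =
      η x * Real.cos (t * x) := by
    intro x
    rw [hexp, Complex.re_ofReal_mul, Complex.exp_ofReal_mul_I_re]
  -- `cos 1 · r ≤ cos 1 · ∫ η ≤ ∫ η cos(tx)`
  have hcos1 : 0 < Real.cos 1 := Real.cos_pos_of_mem_Ioo ⟨by linarith [Real.pi_gt_three],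
    by linarith [Real.pi_gt_three]⟩
  have hind : Integrable fun x : ℝ ↦ (Icc (-(r / 2)) (r / 2)).indicator (1 : ℝ → ℝ) x :=
    (integrable_indicator_iff measurableSet_Icc).2 (integrableOn_const (by simp [Real.volume_Icc]))
  have hηi : Integrable η := hηc.integrable_of_hasCompactSupport hηcs
  have h1 : r ≤ ∫ x, η x := by
    calc r = ∫ x, (Icc (-(r / 2)) (r / 2)).indicator (1 : ℝ → ℝ) x := by
          rw [integral_indicator_one measurableSet_Icc, Real.volume_real_Icc_of_le (by linarith)]; ring
      _ ≤ ∫ x, η x := integral_mono hind hηi fun x ↦ by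
          by_cases hx : x ∈ Icc (-(r / 2)) (r / 2)
          · rw [indicator_of_mem hx, Pi.one_apply, hη1 x (abs_le.2 (by simpa [neg_div] using hx))]
          · rw [indicator_of_notMem hx]; exact (hη01 x).1
  unfold weilMellin
  rw [← RCLike.re_to_complex, ← integral_re hint]
  simp only [RCLike.re_to_complex, hre]
  calc Real.cos 1 * r ≤ Real.cos 1 * ∫ x, η x := mul_le_mul_of_nonneg_left h1 hcos1.le
    _ = ∫ x, Real.cos 1 * η x := (integral_const_mul _ _).symm
    _ ≤ ∫ x, η x * Real.cos (t * x) := by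
        refine integral_mono (hηi.const_mul _) ?_ fun x ↦ ?_
        · exact (hηc.mul (by fun_prop)).integrable_of_hasCompactSupport hηcs.mul_right
        · show Real.cos 1 * η x ≤ η x * Real.cos (t * x)
          by_cases hx : |x| < 3 * r / 4
          · have h2 : |t * x| ≤ 1 := by
              rw [abs_mul]
              calc |t| * |x| ≤ |t| * r := by gcongr; linarith
                _ ≤ 1 := ht
            have hcos : Real.cos 1 ≤ Real.cos (t * x) := by
              rw [← Real.cos_abs (t * x)]
              exact Real.cos_le_cos_of_nonneg_of_le_pi (abs_nonneg _) (by linarith [Real.pi_gt_three]) h2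
            nlinarith [(hη01 x).1]
          · rw [hη0 x (not_lt.1 hx)]
            simp

/-! ## The Weil energy of a plateau: `Re Q(g_r) ≤ r (A + 8 log(1/r))` -/

/-- The archimedean constants used in the bound. -/
private theorem cos_one_pos : 0 < Real.cos 1 :=
  Real.cos_pos_of_mem_Ioo ⟨by linarith [Real.pi_gt_three], by linarith [Real.pi_gt_three]⟩

/-- `w(t) ≤ 1/t` on `(0, 1]` (`w(t) ≤ e^{t/2}/(2t)` and `e^{1/2} ≤ 2`). -/
theorem weilArchDensity_le_inv_of_le_one {t : ℝ} (ht : 0 < t) (ht1 : t ≤ 1) :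
    weilArchDensity t ≤ 1 / t := by
  have h := weilArchDensity_le_exp_half_div ht
  have he : Real.exp (t / 2) ≤ 2 := by
    calc Real.exp (t / 2) ≤ Real.exp (1 / 2) := Real.exp_le_exp.2 (by linarith)
      _ ≤ 2 := by
        have := Real.exp_one_lt_d9
        have h2 : Real.exp (1 / 2) ^ 2 = Real.exp 1 := by rw [← Real.exp_nat_mul]; norm_num
        nlinarith [Real.exp_pos (1 / 2 : ℝ)]
  calc weilArchDensity t ≤ Real.exp (t / 2) / (2 * t) := h
    _ ≤ 2 / (2 * t) := by gcongr
    _ = 1 / t := by field_simp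

/-- **Energy of a plateau.**  There is a constant `A` such that for every `0 < r ≤ (log 2)/2` and every
plateau `η` at scale `r` with Lipschitz constant `L/r` (`exists_plateau`), the test `g = η` satisfies
`Re Q(g) ≤ r · (A + 8 log(1/r))`.  (Markov decomposition on the window `[-r, r]`: pole form
`≤ 8 cosh²(½) r²`, no primes, archimedean energy `≤ (2L² + 2) r + 8 r log(1/r) + 8 r ∫_1^∞ w`,
killing term `≤ 2|M₀| r`.) -/
theorem re_weilQuadratic_plateau_le (L : ℝ) : ∃ A : ℝ, ∀ r : ℝ, 0 < r → r ≤ Real.log 2 / 2 →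
    ∀ η : ℝ → ℝ, ContDiff ℝ ∞ η → (∀ x, 0 ≤ η x ∧ η x ≤ 1) → (∀ x, 3 * r / 4 ≤ |x| → η x = 0) →
      (∀ x y, |η x - η y| ≤ L / r * |x - y|) →
        (weilQuadratic (fun x ↦ ((η x : ℝ) : ℂ))).re ≤ r * (A + 8 * Real.log (1 / r)) := by
  -- the prime-free constants
  set M₀ : ℝ := weilMarkovConstant (Real.log 2 / 2) with hM₀
  set Cw : ℝ := ∫ t in Ioi (1 : ℝ), weilArchDensity t with hCw
  have hCw0 : 0 ≤ Cw := setIntegral_nonneg measurableSet_Ioi fun t ht ↦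
    (weilArchDensity_pos (lt_trans zero_lt_one ht)).le
  refine ⟨8 * Real.cosh (1 / 2) ^ 2 + (2 * L ^ 2 + 2) + 8 + 8 * Cw + 2 * |M₀|,
    fun r hr hr2 η hηs hη01 hη0 hηL ↦ ?_⟩
  have hlog2 : Real.log 2 < 1 := by
    have := Real.log_two_lt_d9; linarith
  have hr1 : r ≤ 1 := by linarith
  obtain ⟨hg, hgs⟩ := isWeilTest_plateau hηs hη0 hr
  set g : ℝ → ℂ := fun x ↦ ((η x : ℝ) : ℂ) with hgdef
  -- window-function data of `g` on `[-r, r]`: `S₀ = 1`, `S₁ = L/r`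
  have hgm : Measurable g := hg.1.continuous.measurable
  have hgz : ∀ x, x ∉ Icc (-r) r → g x = 0 := fun x hx ↦ image_eq_zero_of_notMem_tsupport fun h ↦ hx (hgs h)
  have hgb : ∀ x, ‖g x‖ ≤ 1 := fun x ↦ by
    rw [hgdef]; simp only [Complex.norm_real, Real.norm_eq_abs, abs_le]
    exact ⟨by linarith [(hη01 x).1], (hη01 x).2⟩
  have hgl : ∀ x y, x ∈ Icc (-r) r → y ∈ Icc (-r) r → ‖g y - g x‖ ≤ L / r * |y - x| := fun x y _ _ ↦ by
    rw [hgdef]; simp only [← Complex.ofReal_sub, Complex.norm_real, Real.norm_eq_abs]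
    exact hηL y x
  -- Markov decomposition on the window `[-r, r]`
  rw [weilQuadratic_re_eq_weilPoleForm_add_weilDirichletEnergy_sub hg hgs,
    GroundStateSimpleEven.par_weilDirichletEnergy_eq hr2, GroundStateSimpleEven.par_weilMarkovConstant_eq hr2,
    ← hM₀]
  -- (1) pole form `≤ 8 cosh²(1/2) r²`
  have hvol : (volume (Icc (-r) r)).toReal = 2 * r := by
    rw [Real.volume_Icc, ENNReal.toReal_ofReal (by linarith)]; ring
  have hP : weilPoleForm g ≤ 8 * Real.cosh (1 / 2) ^ 2 * r := by
    have h1 : ‖∫ x : ℝ, g x * (Real.cosh (x / 2) : ℂ)‖ ≤ Real.cosh (1 / 2) * (2 * r) := by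
      rw [← setIntegral_eq_integral_of_forall_compl_eq_zero (s := Icc (-r) r)
        (fun x hx ↦ by rw [hgz x hx, zero_mul]), ← hvol]
      refine norm_setIntegral_le_of_norm_le_const (by rw [Real.volume_Icc]; exact ENNReal.ofReal_lt_top)
        fun x hx ↦ ?_
      have hgx : ‖g x‖ ≤ 1 := hgb x
      have hc : ‖((Real.cosh (x / 2) : ℝ) : ℂ)‖ ≤ Real.cosh (1 / 2) := by
        rw [Complex.norm_real, Real.norm_of_nonneg (Real.cosh_pos _).le, Real.cosh_le_cosh,
          abs_of_pos (by norm_num : (0:ℝ) < 1 / 2)]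
        rw [mem_Icc] at hx
        rw [abs_le]; constructor <;> linarith
      calc ‖g x * ((Real.cosh (x / 2) : ℝ) : ℂ)‖ = ‖g x‖ * ‖((Real.cosh (x / 2) : ℝ) : ℂ)‖ := norm_mul _ _
        _ ≤ 1 * Real.cosh (1 / 2) := mul_le_mul hgx hc (norm_nonneg _) zero_le_one
        _ = Real.cosh (1 / 2) := one_mul _
    have h2 : ‖∫ x : ℝ, g x * (Real.cosh (x / 2) : ℂ)‖ ^ 2 ≤ (Real.cosh (1 / 2) * (2 * r)) ^ 2 :=
      pow_le_pow_left₀ (norm_nonneg _) h1 2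
    unfold weilPoleForm
    nlinarith [sq_nonneg ‖∫ x : ℝ, g x * (Real.sinh (x / 2) : ℂ)‖, Real.cosh_pos (1 / 2 : ℝ),
      sq_nonneg (Real.cosh (1 / 2))]
  -- (2) `‖g‖₂² ≤ 2r`
  have hN : ∫ x : ℝ, ‖g x‖ ^ 2 ≤ 2 * r := by
    rw [← setIntegral_eq_integral_of_forall_compl_eq_zero (s := Icc (-r) r)
      (fun x hx ↦ by rw [hgz x hx, norm_zero]; ring), ← hvol]
    have := norm_setIntegral_le_of_norm_le_const (μ := volume) (s := Icc (-r) r)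
      (f := fun x ↦ ‖g x‖ ^ 2) (C := 1) (by rw [Real.volume_Icc]; exact ENNReal.ofReal_lt_top)
      fun x _ ↦ by
        rw [Real.norm_of_nonneg (by positivity)]
        calc ‖g x‖ ^ 2 ≤ 1 ^ 2 := pow_le_pow_left₀ (norm_nonneg _) (hgb x) 2
          _ = 1 := one_pow 2
    rw [one_mul] at this
    exact (Real.le_norm_self _).trans this
  have hN0 : 0 ≤ ∫ x : ℝ, ‖g x‖ ^ 2 := integral_nonneg fun x ↦ by positivity
  -- (3) archimedean energy, split at `r` and `1`
  have hEint : IntegrableOn (fun t ↦ weilArchDensity t * weilIncrement g t) (Ioi 0) :=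
    integrableOn_weilArchDensity_mul_weilIncrement hg
  have hD1 : ∀ t, 0 < t → t ≤ r → weilArchDensity t * weilIncrement g t ≤ 2 * L ^ 2 + 2 := by
    intro t ht htr
    have hD := weilIncrement_le_window_linear (S₀ := 1) (S₁ := L / r) hr.le hgm hgz hgb hgl ht.le
    have hw := weilArchDensity_le_inv_of_le_one ht (htr.trans hr1)
    calc weilArchDensity t * weilIncrement g t
        ≤ (1 / t) * (2 * r * (L / r) ^ 2 * t ^ 2 + 2 * 1 ^ 2 * t) :=
          mul_le_mul hw hD (weilIncrement_nonneg _ _) (by positivity)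
      _ = 2 * L ^ 2 * (t / r) + 2 := by field_simp
      _ ≤ 2 * L ^ 2 * 1 + 2 := by
          gcongr
          exact (div_le_one hr).2 htr
      _ = 2 * L ^ 2 + 2 := by ring
  have hD2 : ∀ t, r < t → t ≤ 1 → weilArchDensity t * weilIncrement g t ≤ 8 * r * t⁻¹ := by
    intro t ht ht1
    have ht0 : 0 < t := hr.trans ht
    have hD := weilIncrement_le_window_const (S₀ := 1) hr.le hgm hgz hgb t
    have hw := weilArchDensity_le_inv_of_le_one ht0 ht1
    calc weilArchDensity t * weilIncrement g t ≤ (1 / t) * (8 * r * 1 ^ 2) :=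
          mul_le_mul hw hD (weilIncrement_nonneg _ _) (by positivity)
      _ = 8 * r * t⁻¹ := by ring
  have hD3 : ∀ t, 1 < t → weilArchDensity t * weilIncrement g t ≤ weilArchDensity t * (8 * r) := by
    intro t ht
    have hD := weilIncrement_le_window_const (S₀ := 1) hr.le hgm hgz hgb t
    exact mul_le_mul_of_nonneg_left (by simpa using hD) (weilArchDensity_pos (by linarith)).le
  have hsplit : ∫ t in Ioi (0 : ℝ), weilArchDensity t * weilIncrement g t =
      (∫ t in Ioc 0 r, weilArchDensity t * weilIncrement g t) +
      (∫ t in Ioc r 1, weilArchDensity t * weilIncrement g t) +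
      ∫ t in Ioi 1, weilArchDensity t * weilIncrement g t := by
    rw [← Ioc_union_Ioi_eq_Ioi zero_le_one,
      setIntegral_union (Ioc_disjoint_Ioi le_rfl) measurableSet_Ioi
        (hEint.mono_set Ioc_subset_Ioi_self) (hEint.mono_set (Ioi_subset_Ioi zero_le_one)),
      ← Ioc_union_Ioc_eq_Ioc hr.le hr1,
      setIntegral_union (Ioc_disjoint_Ioc_of_le le_rfl) measurableSet_Ioc
        (hEint.mono_set (Ioc_subset_Ioi_self))
        (hEint.mono_set (Ioc_subset_Ioi_self.trans (Ioi_subset_Ioi hr.le)))]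
  have hI1 : ∫ t in Ioc 0 r, weilArchDensity t * weilIncrement g t ≤ (2 * L ^ 2 + 2) * r := by
    calc ∫ t in Ioc 0 r, weilArchDensity t * weilIncrement g t ≤ ∫ t in Ioc 0 r, (2 * L ^ 2 + 2) :=
          setIntegral_mono_on (hEint.mono_set Ioc_subset_Ioi_self) (integrableOn_const (by simp))
            measurableSet_Ioc fun t ht ↦ hD1 t ht.1 ht.2
      _ = (2 * L ^ 2 + 2) * r := by
          rw [setIntegral_const, Real.volume_real_Ioc_of_le hr.le, sub_zero, smul_eq_mul, mul_comm]
  have hI2 : ∫ t in Ioc r 1, weilArchDensity t * weilIncrement g t ≤ 8 * r * Real.log (1 / r) := by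
    have hinv : IntegrableOn (fun t : ℝ ↦ t⁻¹) (Ioc r 1) := by
      refine (ContinuousOn.integrableOn_compact isCompact_Icc ?_).mono_set Ioc_subset_Icc_self
      exact continuousOn_inv₀.mono fun t ht ↦ ne_of_gt (hr.trans_le ht.1)
    calc ∫ t in Ioc r 1, weilArchDensity t * weilIncrement g t ≤ ∫ t in Ioc r 1, 8 * r * t⁻¹ :=
          setIntegral_mono_on (hEint.mono_set (Ioc_subset_Ioi_self.trans (Ioi_subset_Ioi hr.le)))
            (hinv.const_mul _) measurableSet_Ioc fun t ht ↦ hD2 t ht.1 ht.2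
      _ = 8 * r * Real.log (1 / r) := by
          rw [integral_const_mul, ← intervalIntegral.integral_of_le hr1,
            integral_inv (by
              rw [Set.uIcc_of_le hr1, mem_Icc, not_and_or, not_le]; exact Or.inl hr)]
  have hI3 : ∫ t in Ioi 1, weilArchDensity t * weilIncrement g t ≤ 8 * r * Cw := by
    calc ∫ t in Ioi 1, weilArchDensity t * weilIncrement g t ≤ ∫ t in Ioi 1, weilArchDensity t * (8 * r) :=
          setIntegral_mono_on (hEint.mono_set (Ioi_subset_Ioi zero_le_one))
            ((integrableOn_weilArchDensity_Ioi one_pos).mul_const _) measurableSet_Ioi fun t ht ↦ hD3 t ht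
      _ = 8 * r * Cw := by rw [integral_mul_const, hCw, mul_comm]
  -- (4) logs and assembly
  have hlog : 0 ≤ Real.log (1 / r) := Real.log_nonneg ((one_le_div hr).2 hr1)
  have hM : -(M₀ * ∫ x : ℝ, ‖g x‖ ^ 2) ≤ 2 * |M₀| * r := by
    have : |M₀ * ∫ x : ℝ, ‖g x‖ ^ 2| ≤ |M₀| * (2 * r) := by
      rw [abs_mul, abs_of_nonneg hN0]; exact mul_le_mul_of_nonneg_left hN (abs_nonneg _)
    have := neg_abs_le (M₀ * ∫ x : ℝ, ‖g x‖ ^ 2)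
    linarith
  have hr2' : r ^ 2 ≤ r := by nlinarith
  rw [hsplit]
  nlinarith [hP, hI1, hI2, hI3, hM, hlog, hCw0, Real.cosh_pos (1 / 2 : ℝ), sq_nonneg L,
    mul_nonneg hr.le hlog, mul_nonneg hr.le hCw0]

end Summit.RiemannHypothesis.RiemannHypothesis.Theorems.WeilBochnerMeasure

end
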